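import Literature.AnabelianGeometry.SemiGraphs.TemperedAnabelianThm64SubIdentityDatum
import Literature.AnabelianGeometry.EtaleTheta.SettingModelCurve
import Mathlib.Topology.Instances.ZMod
import Literature.AnabelianGeometry.EtaleTheta.SettingModelAugNotOpen
import Mathlib.Topology.Baire.Lemmas
import Mathlib.Topology.Baire.LocallyCompactRegular
import HarnessLib

/-!
# [SemiAnbd] Thm. 6.4 sub-DAG: T64-L04 ([Mzk8] Thm. 1.2 on the interface) at the identity datum is
# INDEPENDENT of the §6 interface — it FAILS at the cell's model curve `F₂ × Γ ↪ F̂₂ × Γ̂`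

S. Mochizuki, *Semi-graphs of anabelioids*, Publ. RIMS **42** (2006) [SemiAnbd], §6, Theorem 6.4, proof
p. 71 ll. 5–8: "by [Mzk8], Theorem 1.2 [i.e., in essence, [Mzk2], Theorem A], we obtain that `φ̂` arises,
up to inner automorphism, from a dominant morphism of schemes `X_K → Y_L`"; [Mzk8] = S. Mochizuki, *Galois
sections in absolute anabelian geometry*, Nagoya Math. J. **179** (2005), Thm. 1.2 p. 5.
[cite: MochizukiSemiAnbd2006, Thm 6.4 proof p.71]

PROOF-ONLY companion (theorems only; no definition, no new fact) of `TemperedAnabelianThm64Sub.lean`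
(abc-iut-w5-d139) and of `TemperedAnabelianThm64SubIdentityDatum.lean` (abc-iut-f-170, p432466); cell
abc-iut, seat abc-iut-f-170, FROZEN FACT-LIST row F-2836 `TemperedCurve.ProfiniteAnabelianTheorem`
(T64-L04).  The companion file showed that T64-L04 HOLDS at the identity datum `⟨Unit, fun _ => id⟩` of
the degenerate inhabitant `Π^temp = Π = G_{ℚ_p}` (there every Galois-compatible open endomorphism of `Π`
is inner).  HERE: at the cell's MODEL CURVE `EtaleTheta.SettingModel.curve p` (abc-iut-L2-t1: `K = ℚ_p`,
`Π^temp = F₂ × Γ` discrete with `Γ = G_{ℚ_p}`, `Π = F̂₂ × Γ̂` the product of the profinite completions,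
augmentation through the second factor) T64-L04 FAILS at the identity datum:

* `not_profiniteAnabelianTheorem_id_settingModel` — the completed generator swap `ŝ : F̂₂ → F̂₂`
  (`ProfiniteCompletion.lift` of `η ∘ (a ↔ b)`, an involution by density, as in abc-iut-w5-d040's
  `TemperedCurveThm65iiiNegative.lean`) gives an OPEN endomorphism `Φ := ŝ × id` of `Π` lying over
  `G_K → G_K`, `h ↦ 1⁻¹ h 1`; the surjectivity half of T64-L04 at the identity datum would make `Φ` inner
  on `Π^temp`, whence `η b = c₁ · η a · c₁⁻¹` in `F̂₂` — impossible, since the continuous extension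
  `F̂₂ → ℤ/2` of `a ↦ 1, b ↦ 0` separates `η a` from every conjugate of `η b`.  (The anabelian content of
  [Mzk8] Thm. 1.2 — open Galois-compatible outer homomorphisms COME FROM geometry — is exactly what the
  abstract interface does not force: `Π` of the model has Galois-compatible outer automorphisms.)
* `profiniteAnabelianTheorem_id_independent` — hence T64-L04 at the identity datum holds at one
  inhabitant of `TemperedCurve p` and fails at another: the row is INDEPENDENT of the [SemiAnbd] §6
  interface axioms (FACT-LIST reading "instance forms open" made precise: consumable BY NAME only, for the
  genuine `π₁^temp` datum, never derivable from the interface).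
* `geometricIsGaloisCompatible_id_settingModel` — for contrast, T64-L01b holds at the same datum.
* (appended, abc-iut-f-170) `not_geometricIsDFG_id_settingModel` / `geometricIsDFG_id_independent` — the
  same for F-2831 / T64-L01: at the model curve `Π^temp = F₂ × Γ` is DISCRETE, so `J = 1` is open normal and
  T64-L01 at the identity datum would make `Π^temp`, hence `Γ = G_{ℚ_p}`, a finitely generated — so countable —
  group, whereas an infinite compact Hausdorff group is uncountable (Baire); with
  `geometricIsDFG_id_degenerate` (p432466) the row T64-L01 at the identity datum is likewise INDEPENDENT of
  the interface.
* (appended, abc-iut-f-170) `not_piTempDFGIffDOF_settingModel` / `piTempDFGIffDOF_independent` — T64-L02 =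
  [SemiAnbd] Lem. 6.3 (ii) (`PiTempDFGIffDOF`) FAILS at the model curve for the same reason: the whole
  discrete `Π^temp` is of DOF-type (dense in the open finite-index subgroup `Π^temp` itself) but not of
  DFG-type (its image in the discrete quotient `Π^temp/1` is not finitely generated); it holds for compact
  `Π^temp` (abc-iut-w6-d055) and under the tower input (abc-iut-w5-d240), so it too is independent of the
  bare interface — as print says, Lem. 6.3 (ii) uses that `Π^temp` is TEMPERED with free discrete
  quotients (Lem. 6.3 (i)), which the model's discrete `F₂ × G_{ℚ_p}` is not.

HONEST LIMITS.  Statements about the cell's kernel models of the interface only; `F₂ × G_{ℚ_p}` is not the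
tempered fundamental group of a hyperbolic curve; nothing of [SemiAnbd] / [Mzk8] is asserted or denied for
curves; typed ≠ proved; nothing here takes a side on [IUTchIII] Cor. 3.12.
-/

noncomputable section

namespace Literature.AnabelianGeometry.SemiGraphs

namespace TemperedCurve

open _root_.Topology
open Literature.AnabelianGeometry.EtaleTheta

variable {p : ℕ} [Fact p.Prime]

/-- **T64-L01b at the identity datum of the model curve** (instance of `geometricIsGaloisCompatible_id`).
[cite: MochizukiSemiAnbd2006, Thm 6.4 pp.70-71] -/
theorem geometricIsGaloisCompatible_id_settingModel (p : ℕ) [Fact p.Prime] :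
    GeometricIsGaloisCompatible
      (⟨Unit, fun _ => ContinuousMonoidHom.id (SettingModel.curve p).PiTemp⟩ :
        TemperedCurveHom p (SettingModel.curve p) (SettingModel.curve p)) :=
  geometricIsGaloisCompatible_id _

/-- **F-2836 / T64-L04 FAILS at the identity datum of the model curve `SettingModel.curve p`.**  The open
endomorphism `ŝ × id` of `Π = F̂₂ × Γ̂` (`ŝ` the completed swap of the free generators) lies over
`G_K → G_K`, `h ↦ 1⁻¹ h 1`, but is not `Π`-conjugate to `π₁(id) = id` on `Π^temp = F₂ × Γ`: that would
conjugate `η a` to `η b` inside `F̂₂`, which the continuous character `F̂₂ → ℤ/2`, `a ↦ 1`, `b ↦ 0`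
forbids. [cite: MochizukiSemiAnbd2006, Thm 6.4 proof p.71] -/
theorem not_profiniteAnabelianTheorem_id_settingModel (p : ℕ) [Fact p.Prime] :
    ¬ ProfiniteAnabelianTheorem
      (⟨Unit, fun _ => ContinuousMonoidHom.id (SettingModel.curve p).PiTemp⟩ :
        TemperedCurveHom p (SettingModel.curve p) (SettingModel.curve p)) := by
  classical
  rintro ⟨hsurj, -⟩
  -- the free generators `a = x₀`, `b = x₁` and the swap `a ↔ b` of `F₂`
  let a : SettingModel.F₂ := FreeGroup.of 0
  let b : SettingModel.F₂ := FreeGroup.of 1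
  let sw : SettingModel.F₂ →* SettingModel.F₂ := FreeGroup.map (Equiv.swap (0 : Fin 2) 1)
  have hswsw : ∀ g, sw (sw g) = g := fun g => by
    change FreeGroup.map _ (FreeGroup.map _ g) = g
    rw [FreeGroup.map.comp]
    have : ((Equiv.swap (0 : Fin 2) 1) ∘ (Equiv.swap (0 : Fin 2) 1) : Fin 2 → Fin 2) = id := by
      funext j; simp [Equiv.swap_apply_self]
    rw [this, FreeGroup.map.id]
  have hswa : sw a = b := by
    change FreeGroup.map _ (FreeGroup.of 0) = FreeGroup.of 1
    rw [FreeGroup.map.of, Equiv.swap_apply_left]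
  -- the completed swap `ŝ : F̂₂ → F̂₂`: `ŝ ∘ η = η ∘ (a ↔ b)`, an involution by density of `η(F₂)`
  let s : SettingModel.F₂hatT →ₜ* SettingModel.F₂hatT :=
    (ProfiniteGrp.ProfiniteCompletion.lift (GrpCat.ofHom (SettingModel.eta.comp sw))).hom
  have hs : ∀ g, s (SettingModel.eta g) = SettingModel.eta (sw g) := fun g =>
    CategoryTheory.ConcreteCategory.congr_hom
      (ProfiniteGrp.ProfiniteCompletion.lift_eta (G := GrpCat.of SettingModel.F₂)
        (GrpCat.ofHom (SettingModel.eta.comp sw))) g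
  have hss : ∀ z, s (s z) = z := by
    have key : (fun z => s (s z)) = id := by
      refine SettingModel.denseRange_eta.equalizer (s.continuous.comp s.continuous) continuous_id ?_
      funext g
      simp only [Function.comp_apply, id_eq]
      rw [hs, hs, hswsw]
    exact fun z => congrFun key z
  -- `Φ := ŝ × id`, an open endomorphism of `Π = F̂₂ × Γ̂` over `G_K → G_K`, `h ↦ 1⁻¹ h 1`
  let Φ : (SettingModel.curve p).PiHat →ₜ* (SettingModel.curve p).PiHat :=
    s.prodMap (ContinuousMonoidHom.id (SettingModel.GamHatT p))
  have hΦapply : ∀ z : SettingModel.PiHt p, Φ z = (s z.1, z.2) := fun z => rfl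
  have hΦ : IsGaloisCompatibleOpenHatHom (SettingModel.curve p) (SettingModel.curve p) Φ := by
    refine ⟨?_, 1, ?_, fun z => ?_⟩
    · have hr : Set.range Φ = Set.univ :=
        Set.eq_univ_of_forall fun z => ⟨(s z.1, z.2), by rw [hΦapply]; exact Prod.ext (hss z.1) rfl⟩
      rw [hr]
      exact isOpen_univ
    · have h1 : ((1 : GQp p) : AlgebraicClosure ℚ_[p] →ₐ[ℚ_[p]] AlgebraicClosure ℚ_[p]) =
          AlgHom.id ℚ_[p] (AlgebraicClosure ℚ_[p]) := by
        ext x; rfl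
      rw [h1, IntermediateField.map_id]
    · rw [inv_one, one_mul, mul_one]
      rfl
  -- the surjectivity half of T64-L04 at the identity datum: `Φ` is `Π`-conjugate to `id` on `Π^temp`
  obtain ⟨⟨⟩, c, hc⟩ := hsurj Φ hΦ
  -- evaluate at `(a, 1) ∈ F₂ × Γ`: first components give `η b = c₁ · η a · c₁⁻¹` in `F̂₂`
  have key : SettingModel.eta b = c.1 * SettingModel.eta a * c.1⁻¹ := by
    have h := congrArg Prod.fst (hc (SettingModel.Del.ofF₂ a, (1 : SettingModel.Gam p)))
    have hx : (SettingModel.curve p).toHat (SettingModel.Del.ofF₂ a, (1 : SettingModel.Gam p)) =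
        (SettingModel.eta a, SettingModel.etaGam p 1) := rfl
    have hid : (ContinuousMonoidHom.id (SettingModel.curve p).PiTemp)
        (SettingModel.Del.ofF₂ a, (1 : SettingModel.Gam p)) =
          (SettingModel.Del.ofF₂ a, (1 : SettingModel.Gam p)) := rfl
    rw [hid, hx, hΦapply] at h
    simp only [Prod.fst_mul, Prod.fst_inv] at h
    rw [hs, hswa] at h
    exact h
  -- the character `F̂₂ → ℤ/2`, `a ↦ 1`, `b ↦ 0`, separates `η b` from the conjugates of `η a`
  let f : SettingModel.F₂ →* Multiplicative (ZMod 2) :=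
    FreeGroup.lift fun j => if j = (0 : Fin 2) then Multiplicative.ofAdd 1 else 1
  have hfa : f a = Multiplicative.ofAdd 1 := by simp [f, a]
  have hfb : f b = 1 := by simp [f, b]
  obtain ⟨F, hF⟩ :=
    SettingModel.exists_continuousMonoidHom_extend SettingModel.F₂ (Multiplicative (ZMod 2)) f
  have hFa : F (SettingModel.eta a) = Multiplicative.ofAdd 1 := by
    rw [SettingModel.eta_apply, hF, hfa]
  have hFb : F (SettingModel.eta b) = 1 := by
    rw [SettingModel.eta_apply, hF, hfb]
  have hcontra : F (SettingModel.eta b) = Multiplicative.ofAdd 1 := by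
    rw [key, map_mul, map_mul, map_inv, hFa, mul_inv_cancel_comm]
  rw [hFb] at hcontra
  exact absurd hcontra (by decide)

/-- **T64-L04 at the identity datum is INDEPENDENT of the §6 interface**: it holds at the degenerate
inhabitant (`profiniteAnabelianTheorem_id_degenerate`, abc-iut-f-170 p432466) and fails at the model
curve (`not_profiniteAnabelianTheorem_id_settingModel`).  [Mzk8] Thm. 1.2 is thus consumable BY NAME
only, for the genuine tempered-`π₁` datum; nothing about it is asserted.
[cite: MochizukiSemiAnbd2006, Thm 6.4 proof p.71] -/
theorem profiniteAnabelianTheorem_id_independent (p : ℕ) [Fact p.Prime] :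
    (∃ X : TemperedCurve p, ProfiniteAnabelianTheorem
        (⟨Unit, fun _ => ContinuousMonoidHom.id X.PiTemp⟩ : TemperedCurveHom p X X)) ∧
      ∃ X : TemperedCurve p, ¬ ProfiniteAnabelianTheorem
        (⟨Unit, fun _ => ContinuousMonoidHom.id X.PiTemp⟩ : TemperedCurveHom p X X) :=
  ⟨⟨_, profiniteAnabelianTheorem_id_degenerate p⟩, ⟨_, not_profiniteAnabelianTheorem_id_settingModel p⟩⟩

/-! ### T64-L01 at the identity datum also FAILS at the model curve: `Π^temp = F₂ × Γ` is discrete and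
`Γ = G_{ℚ_p}` is uncountable, so the discrete quotient `Π^temp/1` is not finitely generated -/

/-- An infinite compact Hausdorff topological group is uncountable (Baire: a countable compact Hausdorff
space has an isolated point; a group with an isolated point is discrete; compact discrete is finite).
[folklore] -/
-- adapted from `EtaleTheta/SettingModelIndependence.lean` (abc-iut-L2-t1), where it is `private`
private theorem not_countable_of_compactSpace_group (G : Type*) [Group G] [TopologicalSpace G]
    [IsTopologicalGroup G] [CompactSpace G] [T2Space G] [Infinite G] : ¬ Countable G := by
  intro hc
  obtain ⟨x, hx⟩ := nonempty_interior_of_iUnion_of_closed (X := G) (f := fun x : G => ({x} : Set G))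
    (fun _ => isClosed_singleton) (by ext y; simp)
  have hopen : IsOpen ({x} : Set G) := by
    obtain ⟨z, hz⟩ := hx
    have hz' : z = x := Set.mem_singleton_iff.mp (interior_subset hz)
    subst hz'
    have hsub : interior ({z} : Set G) = {z} :=
      Set.Subset.antisymm interior_subset (Set.singleton_subset_iff.mpr hz)
    rw [← hsub]
    exact isOpen_interior
  have h1 : IsOpen ({1} : Set G) := by
    have := (Homeomorph.mulLeft x⁻¹).isOpenMap _ hopen
    simpa [Set.image_singleton] using this
  haveI : DiscreteTopology G := discreteTopology_of_isOpen_singleton_one h1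
  haveI : Finite G := finite_of_compact_of_discrete
  exact not_finite G

/-- A finitely generated group is countable (a quotient of a free group on a finite set). [folklore] -/
private theorem countable_of_group_fg (G : Type*) [Group G] (h : Group.FG G) : Countable G := by
  obtain ⟨S, hS, φ, hφ⟩ := Group.fg_iff_exists_freeGroup_hom_surjective.mp h
  haveI : Finite S := hS.to_subtype
  exact hφ.countable

/-- `G_{ℚ_p}` (Krull topology) is uncountable: an infinite compact Hausdorff group.
[cite: MochizukiSemiAnbd2006, §6 p.69] -/
theorem not_countable_GQp (p : ℕ) [Fact p.Prime] : ¬ Countable (GQp p) := by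
  haveI : CompactSpace (GQp p) := SettingModel.compactSpace_GQp p
  haveI : T2Space (GQp p) := krullTopology_t2
  haveI : Infinite (GQp p) := SettingModel.infinite_GQp p
  exact not_countable_of_compactSpace_group (GQp p)

/-- The model's DISCRETE `Π^temp = F₂ × Γ` (`Γ = G_{ℚ_p}` as an abstract group) is not finitely generated:
it is uncountable (it contains `1 × Γ`). [cite: MochizukiSemiAnbd2006, Def 6.2(i) pp.69-70] -/
theorem not_fg_piTemp_settingModel (p : ℕ) [Fact p.Prime] :
    ¬ Group.FG (SettingModel.curve p).PiTemp := by
  intro h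
  haveI : Countable (SettingModel.PiTp p) := countable_of_group_fg _ h
  -- `σ ↦ (1, σ)` injects `Γ = G_{ℚ_p}` into `F₂ × Γ`
  have hinj : Function.Injective
      (fun σ : GQp p => (((1 : SettingModel.Del), σ) : SettingModel.PiTp p)) :=
    fun σ τ hστ => congrArg Prod.snd hστ
  exact not_countable_GQp p hinj.countable

/-- **F-2831 / T64-L01 FAILS at the identity datum of the model curve `SettingModel.curve p`**: `Π^temp`
is discrete, so the trivial subgroup is open normal, and `π₁^temp(id) = id` of DFG-type would make the
discrete quotient `Π^temp/1 ≅ Π^temp ⊇ G_{ℚ_p}` finitely generated (`geometricIsDFG_id_iff`).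
[cite: MochizukiSemiAnbd2006, Thm 6.4 proof p.71] -/
theorem not_geometricIsDFG_id_settingModel (p : ℕ) [Fact p.Prime] :
    ¬ GeometricIsDFG
      (⟨Unit, fun _ => ContinuousMonoidHom.id (SettingModel.curve p).PiTemp⟩ :
        TemperedCurveHom p (SettingModel.curve p) (SettingModel.curve p)) := by
  intro h
  -- the trivial subgroup of the DISCRETE group `Π^temp = F₂ × Γ` is an open normal subgroup
  let J : OpenNormalSubgroup (SettingModel.curve p).PiTemp := ⟨⟨⊥, isOpen_discrete _⟩, inferInstance⟩
  haveI : Group.FG ((SettingModel.curve p).PiTemp ⧸ (⊥ : Subgroup (SettingModel.curve p).PiTemp)) :=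
    (geometricIsDFG_id_iff _).mp h J
  exact not_fg_piTemp_settingModel p
    (Group.fg_of_surjective
      (f := (QuotientGroup.quotientBot :
        (SettingModel.curve p).PiTemp ⧸ (⊥ : Subgroup (SettingModel.curve p).PiTemp) ≃* _).toMonoidHom)
      QuotientGroup.quotientBot.surjective)

/-- **T64-L01 at the identity datum is INDEPENDENT of the §6 interface**: it holds at the degenerate
inhabitant (`geometricIsDFG_id_degenerate`, p432466; also at the non-compact tempered witness,
`exists_noncompact_identityDatum_steps`) and fails at the model curve (`not_geometricIsDFG_id_settingModel`).
[cite: MochizukiSemiAnbd2006, Thm 6.4 proof p.71] -/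
theorem geometricIsDFG_id_independent (p : ℕ) [Fact p.Prime] :
    (∃ X : TemperedCurve p, GeometricIsDFG
        (⟨Unit, fun _ => ContinuousMonoidHom.id X.PiTemp⟩ : TemperedCurveHom p X X)) ∧
      ∃ X : TemperedCurve p, ¬ GeometricIsDFG
        (⟨Unit, fun _ => ContinuousMonoidHom.id X.PiTemp⟩ : TemperedCurveHom p X X) :=
  ⟨⟨_, geometricIsDFG_id_degenerate p⟩, ⟨_, not_geometricIsDFG_id_settingModel p⟩⟩

/-! ### T64-L02 = Lemma 6.3 (ii) also FAILS at the model curve -/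

/-- **T64-L02 = [SemiAnbd] Lem. 6.3 (ii) (`PiTempDFGIffDOF`) FAILS at the model curve
`SettingModel.curve p`**: the discrete `Π^temp = F₂ × Γ` is a subgroup of itself of DOF-type (it is open
of finite index and closed), but not of DFG-type — its image in the discrete quotient by the open normal
subgroup `1` is `Π^temp` itself, which is not finitely generated (`not_fg_piTemp_settingModel`).
(Print, p. 70, proves (ii) from (i) for the TEMPERED `Π^temp_{X_K}`, whose discrete quotients are
virtually free of finite rank; the model's `Π^temp` is not of this kind.)
[cite: MochizukiSemiAnbd2006, Lem 6.3(ii) p.70] -/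
theorem not_piTempDFGIffDOF_settingModel (p : ℕ) [Fact p.Prime] :
    ¬ (SettingModel.curve p).PiTempDFGIffDOF := by
  intro h
  -- `⊤` is of DOF-type in the discrete group `Π^temp`
  have hDOF : IsDOFType (⊤ : Subgroup (SettingModel.curve p).PiTemp) :=
    ⟨⊤, isOpen_discrete _, inferInstance, by rw [Subgroup.coe_top, closure_univ]⟩
  -- hence of DFG-type: its image in `Π^temp ⧸ 1` is finitely generated
  obtain ⟨-, hfg⟩ := (h ⊤).mpr hDOF
  let J : OpenNormalSubgroup (SettingModel.curve p).PiTemp := ⟨⟨⊥, isOpen_discrete _⟩, inferInstance⟩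
  have h1 := hfg J
  rw [Subgroup.map_top_of_surjective _ (QuotientGroup.mk'_surjective _)] at h1
  haveI : Group.FG ((SettingModel.curve p).PiTemp ⧸ (⊥ : Subgroup (SettingModel.curve p).PiTemp)) :=
    Group.fg_def.mpr h1
  exact not_fg_piTemp_settingModel p
    (Group.fg_of_surjective
      (f := (QuotientGroup.quotientBot :
        (SettingModel.curve p).PiTemp ⧸ (⊥ : Subgroup (SettingModel.curve p).PiTemp) ≃* _).toMonoidHom)
      QuotientGroup.quotientBot.surjective)

/-- **T64-L02 = Lem. 6.3 (ii) is INDEPENDENT of the §6 interface**: it holds at the degenerate (compact)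
inhabitant (`piTempDFGIffDOF_degenerate`, p432466, via abc-iut-w6-d055's `piTempDFGIffDOF_of_compactSpace`;
and at the non-compact tempered witness, `exists_noncompact_identityDatum_steps`) and fails at the model
curve (`not_piTempDFGIffDOF_settingModel`). [cite: MochizukiSemiAnbd2006, Lem 6.3(ii) p.70] -/
theorem piTempDFGIffDOF_independent (p : ℕ) [Fact p.Prime] :
    (∃ X : TemperedCurve p, X.PiTempDFGIffDOF) ∧ ∃ X : TemperedCurve p, ¬ X.PiTempDFGIffDOF :=
  ⟨⟨_, piTempDFGIffDOF_degenerate p⟩, ⟨_, not_piTempDFGIffDOF_settingModel p⟩⟩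

/-- **Summary at the model curve**: of the inputs of the sharpened assembly
`temperedAnabelianTheorem_of_inputs` (T64-L01, L01b, L02, L04, L06′) at the identity datum of
`SettingModel.curve p`, T64-L01b holds while T64-L01, T64-L02 and T64-L04 all FAIL — the three carry
genuine content about `Π^temp_{X_K}` (topological finite generation / temperedness / anabelian rigidity)
that the bare interface `TemperedCurve p` does not record. [cite: MochizukiSemiAnbd2006, Thm 6.4 proof p.71] -/
theorem identityDatum_settingModel_summary (p : ℕ) [Fact p.Prime] :
    GeometricIsGaloisCompatible
        (⟨Unit, fun _ => ContinuousMonoidHom.id (SettingModel.curve p).PiTemp⟩ :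
          TemperedCurveHom p (SettingModel.curve p) (SettingModel.curve p)) ∧
      ¬ GeometricIsDFG
        (⟨Unit, fun _ => ContinuousMonoidHom.id (SettingModel.curve p).PiTemp⟩ :
          TemperedCurveHom p (SettingModel.curve p) (SettingModel.curve p)) ∧
      ¬ (SettingModel.curve p).PiTempDFGIffDOF ∧
      ¬ ProfiniteAnabelianTheorem
        (⟨Unit, fun _ => ContinuousMonoidHom.id (SettingModel.curve p).PiTemp⟩ :
          TemperedCurveHom p (SettingModel.curve p) (SettingModel.curve p)) :=
  ⟨geometricIsGaloisCompatible_id_settingModel p, not_geometricIsDFG_id_settingModel p,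
    not_piTempDFGIffDOF_settingModel p, not_profiniteAnabelianTheorem_id_settingModel p⟩

end TemperedCurve

end Literature.AnabelianGeometry.SemiGraphs

end
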